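import Literature.MathematicalPhysics.QuantumLattice.PatchPairOperator
import Literature.MathematicalPhysics.QuantumLattice.HubbardFreeCovariance
import Literature.MathematicalPhysics.QuantumLattice.FinDimSpectrumProofs
import Literature.MathematicalPhysics.QuantumLattice.HubbardWave0Proofs
import HarnessLib

/-!
# Fully paired product states `Π_{k∈l} b†_k|0⟩` and the Fermi-sea energy bound on the torus

Family `hubbard` / trunk T-QLATTICE. The `u = 0, v = 1` case of the BCS product vectors in momentum
space: `Φ_l = Π_{k ∈ l} b†_k |0⟩`, `b†_k = (pairMode k)ᴴ = c†_{k↑} c†_{-k↓}` (`ReducedBCSTorus.lean`),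
written as a `List.prod` (local notation, no definition). From the momentum-space CAR and the
hard-core boson relations (`pairMode_comm`, `pairMode_commutator_conjTranspose`) and `c|0⟩ = 0`:

* the factors commute, `Φ_l` depends on `l` only up to permutation, `Φ_l = b†_q Φ_{l∖q}` for `q ∈ l`;
* `c_{q↑}Φ_l = 0`, `c_{-q↓}Φ_l = 0`, `b_qΦ_l = 0`, `n_{q↑}Φ_l = n_{-q↓}Φ_l = 0` for `q ∉ l`, and
  `n_{q↑}Φ_l = n_{-q↓}Φ_l = Φ_l` for `q ∈ l`; `⟨Φ_l, Φ_l⟩ = 1` for duplicate-free `l`;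
* the free grand-canonical torus Hamiltonian regrouped over time-reversed pairs,
  `H(1,0) - μN = Σ_k ξ_k (n_{k↑} + n_{-k↓})` (`hubbardTorusWith_zero_eq_sum_pairBlock_kinetic`, `L ≥ 3`;
  `hubbardTorusWith_zero_eq_sum_momentumNumber`, `torusBand_neg`), `⟨Φ_l, (n_{q↑}+n_{-q↓})Φ_l⟩ = 2[q ∈ l]`,
  and the **Fermi-sea variational bound** `E₀(H(1,0) - μN) ≤ 2 Σ_{k ∈ F} (ε_L(k) - μ)` for every finite
  set `F` of momenta (`groundEnergy_hubbardTorusWith_zero_le_two_mul_sum`), in particular `≤ Σ_k 2min(ξ_k,0)`.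

The same calculus with general Bogoliubov factors `u_k + v_k b†_k` is carried out summit-side in
`Summits/HubbardSuperconductivity/…/Theorems/ThermalWedgeTwTipContinuationEdgeOrderProductState.lean`
(not importable from Literature); the statements here are the textbook BCS manipulations
(Bardeen–Cooper–Schrieffer 1957 §II; von Delft–Ralph 2001 §4.2.3). Consumer:
`FreeFermiGasNoDWaveOrder.lean` (`dWaveOrderParameter 0 μ = 0`). No named facts, no definitions.
-/

noncomputable section

namespace Literature.MathematicalPhysics.QuantumLattice

open Matrix Finset Literature.Probability.LatticeModels
open scoped ComplexOrder ComplexConjugate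

variable {L : ℕ} [NeZero L]

/-- The fully paired product vector `Φ_l = Π_{k ∈ l} b†_k |0⟩` (local notation for the literal term). -/
local notation "Φ[" l "]" =>
  (List.prod (List.map (fun k : TorusSite 2 _ => (pairMode k)ᴴ) l) *ᵥ
    (vacuum : Fock (Orb (FermionTorus 2 _))))

/-! ### Algebra of pair creators -/

/-- `b†_k b†_{k'} = b†_{k'} b†_k`. [folklore] -/
theorem pairMode_conjTranspose_comm (k k' : TorusSite 2 L) :
    (pairMode k)ᴴ * (pairMode k')ᴴ = (pairMode k')ᴴ * (pairMode k)ᴴ := by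
  rw [← conjTranspose_mul, ← conjTranspose_mul, pairMode_comm]

/-- Unfolding the paired vector along `k :: l`. [folklore] -/
theorem pairedState_cons (k : TorusSite 2 L) (l : List (TorusSite 2 L)) :
    Φ[k :: l] = (pairMode k)ᴴ *ᵥ Φ[l] := by
  simp only [List.map_cons, List.prod_cons, mulVec_mulVec]

/-- The empty product is the vacuum. [folklore] -/
theorem pairedState_nil : Φ[([] : List (TorusSite 2 L))] = vacuum := by
  simp only [List.map_nil, List.prod_nil, one_mulVec]

/-- The paired vector only depends on the list up to permutation. [folklore] -/
theorem pairedState_perm {l l' : List (TorusSite 2 L)} (h : l.Perm l') : Φ[l] = Φ[l'] := by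
  have hc : (List.map (fun k : TorusSite 2 L => (pairMode k)ᴴ) l).Pairwise Commute :=
    List.pairwise_map.2 (List.pairwise_of_forall fun a b => pairMode_conjTranspose_comm a b)
  rw [(h.map _).prod_eq' hc]

/-- Peeling the factor of `q ∈ l`: `Φ_l = b†_q Φ_{l∖q}`. [folklore] -/
theorem pairedState_eq_of_mem {l : List (TorusSite 2 L)} {q : TorusSite 2 L} (hq : q ∈ l) :
    Φ[l] = (pairMode q)ᴴ *ᵥ Φ[l.erase q] := by
  rw [pairedState_perm (List.perm_cons_erase hq), pairedState_cons]

/-! ### CAR bookkeeping -/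

/-- `c_{kσ} |0⟩ = 0` for the Bloch modes. [folklore] -/
theorem momentumAnnihilation_mulVec_vacuum (k : TorusSite 2 L) (σ : Fin 2) :
    momentumAnnihilation k σ *ᵥ (vacuum : Fock (Orb (FermionTorus 2 L))) = 0 := by
  unfold momentumAnnihilation
  rw [sum_mulVec]
  refine Finset.sum_eq_zero fun x _ => ?_
  rw [smul_mulVec, annihilation_mulVec_vacuum_holds, smul_zero]

omit [NeZero L] in
/-- `⟨0|0⟩ = 1` on the fermionic torus. [folklore] -/
theorem star_vacuum_dotProduct_vacuum :
    star (vacuum : Fock (Orb (FermionTorus 2 L))) ⬝ᵥ vacuum = 1 := by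
  simp [vacuum, dotProduct, Pi.single_apply]

/-- `c_{q↑} b†_k = b†_k c_{q↑} + δ_{qk} c†_{−k↓}`. [folklore] -/
theorem momentumAnnihilation_up_mul_pairMode_conjTranspose (q k : TorusSite 2 L) :
    momentumAnnihilation q 0 * (pairMode k)ᴴ =
      (pairMode k)ᴴ * momentumAnnihilation q 0 + (if q = k then momentumCreation (-k) 1 else 0) := by
  rw [pairMode_conjTranspose, ← Matrix.mul_assoc, momentumAnnihilation_mul_momentumCreation, sub_mul,
    Matrix.mul_assoc, momentumAnnihilation_mul_momentumCreation]
  have h01 : ¬ (q = -k ∧ (0 : Fin 2) = 1) := fun h => absurd h.2 (by decide)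
  rw [if_neg h01, zero_sub, mul_neg, sub_neg_eq_add, ← Matrix.mul_assoc, add_comm]
  congr 1
  by_cases hqk : q = k
  · rw [if_pos ⟨hqk, rfl⟩, if_pos hqk, Matrix.one_mul]
  · rw [if_neg (fun h => hqk h.1), if_neg hqk, Matrix.zero_mul]

/-- `c_{q↓} b†_k = b†_k c_{q↓} − δ_{q,−k} c†_{k↑}`. [folklore] -/
theorem momentumAnnihilation_down_mul_pairMode_conjTranspose (q k : TorusSite 2 L) :
    momentumAnnihilation q 1 * (pairMode k)ᴴ =
      (pairMode k)ᴴ * momentumAnnihilation q 1 - (if q = -k then momentumCreation k 0 else 0) := by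
  rw [pairMode_conjTranspose, ← Matrix.mul_assoc, momentumAnnihilation_mul_momentumCreation]
  have h10 : ¬ (q = k ∧ (1 : Fin 2) = 0) := fun h => absurd h.2 (by decide)
  rw [if_neg h10, zero_sub, neg_mul, Matrix.mul_assoc, momentumAnnihilation_mul_momentumCreation,
    mul_sub, ← Matrix.mul_assoc, neg_sub, sub_eq_neg_add]
  by_cases hqk : q = -k
  · rw [if_pos ⟨hqk, rfl⟩, if_pos hqk, Matrix.mul_one]; abel
  · rw [if_neg (fun h => hqk h.1), if_neg hqk, Matrix.mul_zero]; abel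

/-- `n_{kσ} c†_{kσ} = c†_{kσ}` (Pauli). [folklore] -/
theorem momentumNumber_mul_momentumCreation_self (k : TorusSite 2 L) (σ : Fin 2) :
    momentumNumber k σ * momentumCreation k σ = momentumCreation k σ := by
  rw [momentumNumber, Matrix.mul_assoc, momentumAnnihilation_mul_momentumCreation, if_pos ⟨rfl, rfl⟩,
    mul_sub, Matrix.mul_one, ← Matrix.mul_assoc, momentumCreation_mul_self, Matrix.zero_mul, sub_zero]

/-- `n_{kσ} c†_{k'σ'} = c†_{k'σ'} n_{kσ}` for different modes. [folklore] -/
theorem momentumNumber_mul_momentumCreation_of_ne {k k' : TorusSite 2 L} {σ σ' : Fin 2}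
    (h : ¬ (k = k' ∧ σ = σ')) :
    momentumNumber k σ * momentumCreation k' σ' = momentumCreation k' σ' * momentumNumber k σ := by
  rw [momentumNumber, Matrix.mul_assoc, momentumAnnihilation_mul_momentumCreation, if_neg h, zero_sub,
    mul_neg, ← Matrix.mul_assoc, momentumCreation_mul_eq_neg k k' σ σ', neg_mul, neg_neg, Matrix.mul_assoc]

/-- `n_{q↑} b†_q = b†_q`. [folklore] -/
theorem momentumNumber_up_mul_pairMode_conjTranspose (q : TorusSite 2 L) :
    momentumNumber q 0 * (pairMode q)ᴴ = (pairMode q)ᴴ := by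
  rw [pairMode_conjTranspose, ← Matrix.mul_assoc, momentumNumber_mul_momentumCreation_self]

/-- `n_{−q↓} b†_q = b†_q`. [folklore] -/
theorem momentumNumber_down_mul_pairMode_conjTranspose (q : TorusSite 2 L) :
    momentumNumber (-q) 1 * (pairMode q)ᴴ = (pairMode q)ᴴ := by
  have h : ¬ (-q = q ∧ (1 : Fin 2) = 0) := fun h => absurd h.2 (by decide)
  rw [pairMode_conjTranspose, ← Matrix.mul_assoc, momentumNumber_mul_momentumCreation_of_ne h,
    Matrix.mul_assoc, momentumNumber_mul_momentumCreation_self]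

/-- `n_{q↑} b†_k = b†_k n_{q↑}` for `q ≠ k`. [folklore] -/
theorem momentumNumber_up_mul_pairMode_conjTranspose_of_ne {q k : TorusSite 2 L} (hqk : q ≠ k) :
    momentumNumber q 0 * (pairMode k)ᴴ = (pairMode k)ᴴ * momentumNumber q 0 := by
  have h1 : ¬ (q = k ∧ (0 : Fin 2) = 0) := fun h => hqk h.1
  have h2 : ¬ (q = -k ∧ (0 : Fin 2) = 1) := fun h => absurd h.2 (by decide)
  rw [pairMode_conjTranspose, ← Matrix.mul_assoc, momentumNumber_mul_momentumCreation_of_ne h1,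
    Matrix.mul_assoc, momentumNumber_mul_momentumCreation_of_ne h2, ← Matrix.mul_assoc]

/-- `n_{−q↓} b†_k = b†_k n_{−q↓}` for `q ≠ k`. [folklore] -/
theorem momentumNumber_down_mul_pairMode_conjTranspose_of_ne {q k : TorusSite 2 L} (hqk : q ≠ k) :
    momentumNumber (-q) 1 * (pairMode k)ᴴ = (pairMode k)ᴴ * momentumNumber (-q) 1 := by
  have h1 : ¬ (-q = k ∧ (1 : Fin 2) = 0) := fun h => absurd h.2 (by decide)
  have h2 : ¬ (-q = -k ∧ (1 : Fin 2) = 1) := fun h => hqk (neg_injective h.1)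
  rw [pairMode_conjTranspose, ← Matrix.mul_assoc, momentumNumber_mul_momentumCreation_of_ne h1,
    Matrix.mul_assoc, momentumNumber_mul_momentumCreation_of_ne h2, ← Matrix.mul_assoc]

/-! ### Annihilators and number operators on the paired vector -/

/-- `c_{q↑} Φ_l = 0` for `q ∉ l`. [folklore] -/
theorem momentumAnnihilation_up_pairedState_of_not_mem {l : List (TorusSite 2 L)} {q : TorusSite 2 L}
    (hq : q ∉ l) : momentumAnnihilation q 0 *ᵥ Φ[l] = 0 := by
  induction l with
  | nil => rw [pairedState_nil, momentumAnnihilation_mulVec_vacuum]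
  | cons k l ih =>
    have hqk : q ≠ k := fun h => hq (h ▸ List.mem_cons_self)
    have hql : q ∉ l := fun h => hq (List.mem_cons_of_mem _ h)
    rw [pairedState_cons, mulVec_mulVec, momentumAnnihilation_up_mul_pairMode_conjTranspose, if_neg hqk,
      add_zero, ← mulVec_mulVec, ih hql, mulVec_zero]

/-- `c_{q↓} Φ_l = 0` for `−q ∉ l`. [folklore] -/
theorem momentumAnnihilation_down_pairedState_of_not_mem {l : List (TorusSite 2 L)} {q : TorusSite 2 L}
    (hq : -q ∉ l) : momentumAnnihilation q 1 *ᵥ Φ[l] = 0 := by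
  induction l with
  | nil => rw [pairedState_nil, momentumAnnihilation_mulVec_vacuum]
  | cons k l ih =>
    have hqk : q ≠ -k := fun h => hq (by rw [h, neg_neg]; exact List.mem_cons_self)
    have hql : -q ∉ l := fun h => hq (List.mem_cons_of_mem _ h)
    rw [pairedState_cons, mulVec_mulVec, momentumAnnihilation_down_mul_pairMode_conjTranspose, if_neg hqk,
      sub_zero, ← mulVec_mulVec, ih hql, mulVec_zero]

/-- `b_q Φ_l = 0` for `q ∉ l`. [folklore] -/
theorem pairMode_pairedState_of_not_mem {l : List (TorusSite 2 L)} {q : TorusSite 2 L} (hq : q ∉ l) :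
    pairMode q *ᵥ Φ[l] = 0 := by
  rw [pairMode, ← mulVec_mulVec, momentumAnnihilation_up_pairedState_of_not_mem hq, mulVec_zero]

/-- `n_{q↑} Φ_l = 0` for `q ∉ l`. [folklore] -/
theorem momentumNumber_up_pairedState_of_not_mem {l : List (TorusSite 2 L)} {q : TorusSite 2 L}
    (hq : q ∉ l) : momentumNumber q 0 *ᵥ Φ[l] = 0 := by
  rw [momentumNumber, ← mulVec_mulVec, momentumAnnihilation_up_pairedState_of_not_mem hq, mulVec_zero]

/-- `n_{−q↓} Φ_l = 0` for `q ∉ l`. [folklore] -/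
theorem momentumNumber_down_pairedState_of_not_mem {l : List (TorusSite 2 L)} {q : TorusSite 2 L}
    (hq : q ∉ l) : momentumNumber (-q) 1 *ᵥ Φ[l] = 0 := by
  rw [momentumNumber, ← mulVec_mulVec,
    momentumAnnihilation_down_pairedState_of_not_mem (q := -q) (by rwa [neg_neg]), mulVec_zero]

/-- `b_q b†_q Φ_l = Φ_l` for `q ∉ l`. [folklore] -/
theorem pairMode_pairMode_conjTranspose_pairedState_of_not_mem {l : List (TorusSite 2 L)}
    {q : TorusSite 2 L} (hq : q ∉ l) : pairMode q *ᵥ ((pairMode q)ᴴ *ᵥ Φ[l]) = Φ[l] := by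
  have h := pairMode_commutator_conjTranspose q q
  rw [if_pos rfl, sub_eq_iff_eq_add] at h
  rw [mulVec_mulVec, h, add_mulVec, sub_mulVec, sub_mulVec, one_mulVec, ← mulVec_mulVec,
    pairMode_pairedState_of_not_mem hq, mulVec_zero, add_zero,
    momentumNumber_up_pairedState_of_not_mem hq, momentumNumber_down_pairedState_of_not_mem hq,
    sub_zero, sub_zero]

/-- `n_{q↑} Φ_l = Φ_l` for `q ∈ l`. [folklore] -/
theorem momentumNumber_up_pairedState_of_mem {l : List (TorusSite 2 L)} {q : TorusSite 2 L}
    (hq : q ∈ l) : momentumNumber q 0 *ᵥ Φ[l] = Φ[l] := by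
  rw [pairedState_eq_of_mem hq, mulVec_mulVec, momentumNumber_up_mul_pairMode_conjTranspose]

/-- `n_{−q↓} Φ_l = Φ_l` for `q ∈ l`. [folklore] -/
theorem momentumNumber_down_pairedState_of_mem {l : List (TorusSite 2 L)} {q : TorusSite 2 L}
    (hq : q ∈ l) : momentumNumber (-q) 1 *ᵥ Φ[l] = Φ[l] := by
  rw [pairedState_eq_of_mem hq, mulVec_mulVec, momentumNumber_down_mul_pairMode_conjTranspose]

omit [NeZero L] in
/-- `⟨x, Aᴴ y⟩ = ⟨A x, y⟩` in `dotProduct` form. [folklore] -/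
private theorem star_dotProduct_conjTranspose_mulVec_aux {n : Type*} [Fintype n] (A : Matrix n n ℂ)
    (x y : n → ℂ) : star x ⬝ᵥ (Aᴴ *ᵥ y) = star (A *ᵥ x) ⬝ᵥ y := by
  rw [star_mulVec, dotProduct_mulVec]

/-- **Normalisation**: `⟨Φ_l, Φ_l⟩ = 1` for a duplicate-free `l`. [folklore] -/
theorem star_pairedState_dotProduct_self {l : List (TorusSite 2 L)} (hl : l.Nodup) :
    star (Φ[l]) ⬝ᵥ Φ[l] = 1 := by
  induction l with
  | nil => rw [pairedState_nil, star_vacuum_dotProduct_vacuum]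
  | cons k l ih =>
    obtain ⟨hk, hl'⟩ := List.nodup_cons.1 hl
    have h := star_dotProduct_conjTranspose_mulVec_aux (pairMode k)ᴴ (Φ[l]) ((pairMode k)ᴴ *ᵥ Φ[l])
    rw [conjTranspose_conjTranspose] at h
    rw [pairedState_cons, ← h, pairMode_pairMode_conjTranspose_pairedState_of_not_mem hk, ih hl']

/-! ### The kinetic energy on the paired vector -/

/-- **The grand-canonical free torus Hamiltonian regrouped over time-reversed pairs** (`L ≥ 3`):
`H(1,0) - μN = Σ_k ξ_k (n_{k↑} + n_{-k↓})`, `ξ_k = ε_L(k) - μ` (`ε_L(-k) = ε_L(k)`). [folklore] -/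
theorem hubbardTorusWith_zero_eq_sum_pairBlock_kinetic (hL : 3 ≤ L) (μ : ℝ) :
    hubbardTorusWith 2 L 1 0 μ = ∑ k : TorusSite 2 L,
      ((torusBand L k - μ : ℝ) : ℂ) • (momentumNumber k 0 + momentumNumber (-k) 1) := by
  rw [hubbardTorusWith_zero_eq_sum_momentumNumber hL]
  have hneg : ∑ k : TorusSite 2 L, ((torusBand L k - μ : ℝ) : ℂ) • momentumNumber k 1 =
      ∑ k : TorusSite 2 L, ((torusBand L k - μ : ℝ) : ℂ) • momentumNumber (-k) 1 := by
    rw [← Equiv.sum_comp (Equiv.neg (TorusSite 2 L))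
      (fun k => ((torusBand L k - μ : ℝ) : ℂ) • momentumNumber k 1)]
    refine Finset.sum_congr rfl fun k _ => ?_
    simp only [Equiv.neg_apply, torusBand_neg]
  calc ∑ k : TorusSite 2 L, ∑ σ : Fin 2, ((torusBand L k - μ : ℝ) : ℂ) • momentumNumber k σ
      = ∑ k : TorusSite 2 L, (((torusBand L k - μ : ℝ) : ℂ) • momentumNumber k 0 +
          ((torusBand L k - μ : ℝ) : ℂ) • momentumNumber k 1) :=
        Finset.sum_congr rfl fun k _ => Fin.sum_univ_two _
    _ = ∑ k : TorusSite 2 L, ((torusBand L k - μ : ℝ) : ℂ) • momentumNumber k 0 +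
          ∑ k : TorusSite 2 L, ((torusBand L k - μ : ℝ) : ℂ) • momentumNumber k 1 :=
        Finset.sum_add_distrib
    _ = ∑ k : TorusSite 2 L, ((torusBand L k - μ : ℝ) : ℂ) • momentumNumber k 0 +
          ∑ k : TorusSite 2 L, ((torusBand L k - μ : ℝ) : ℂ) • momentumNumber (-k) 1 := by rw [hneg]
    _ = _ := by
        rw [← Finset.sum_add_distrib]
        exact Finset.sum_congr rfl fun k _ => (smul_add _ _ _).symm

/-- `⟨Φ_l, (n_{q↑} + n_{-q↓}) Φ_l⟩ = 2·[q ∈ l]` for a duplicate-free `l`. [folklore] -/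
theorem star_pairedState_dotProduct_pairNumber_mulVec {l : List (TorusSite 2 L)} (hl : l.Nodup)
    (q : TorusSite 2 L) :
    star (Φ[l]) ⬝ᵥ ((momentumNumber q 0 + momentumNumber (-q) 1) *ᵥ Φ[l]) =
      if q ∈ l then 2 else 0 := by
  rw [add_mulVec]
  by_cases hq : q ∈ l
  · rw [momentumNumber_up_pairedState_of_mem hq, momentumNumber_down_pairedState_of_mem hq, if_pos hq,
      dotProduct_add, star_pairedState_dotProduct_self hl]
    norm_num
  · rw [momentumNumber_up_pairedState_of_not_mem hq, momentumNumber_down_pairedState_of_not_mem hq,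
      if_neg hq, add_zero, dotProduct_zero]

/-- **The paired vector is a trial state of kinetic energy `2 Σ_{k ∈ F} ξ_k`**: for every finite
set `F` of momenta and `L ≥ 3`,
`E₀(H(1,0) - μN) ≤ 2 Σ_{k ∈ F} (ε_L(k) - μ)` (variational principle with `Φ_{F}`).
In particular (`F = {ξ_k < 0}`) the free grand-canonical ground-state energy is at most the
Fermi-sea value `Σ_k 2 min(ξ_k, 0)`. [folklore] -/
theorem groundEnergy_hubbardTorusWith_zero_le_two_mul_sum (hL : 3 ≤ L) (μ : ℝ)
    (F : Finset (TorusSite 2 L)) :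
    (hubbardTorusWith 2 L 1 0 μ).groundEnergy ≤ 2 * ∑ k ∈ F, (torusBand L k - μ) := by
  classical
  set l : List (TorusSite 2 L) := F.toList with hl
  have hnd : l.Nodup := F.nodup_toList
  have hmem : ∀ q, q ∈ l ↔ q ∈ F := fun q => Finset.mem_toList
  have hK := isHermitian_hamiltonianWith_zero (fermionTorusGraph 2 L) 1 μ
  have hray := groundEnergy_le_rayleigh_holds hK (Φ[l]) (star_pairedState_dotProduct_self hnd)
  refine hray.trans (le_of_eq ?_)
  change (star (Φ[l]) ⬝ᵥ (hubbardTorusWith 2 L 1 0 μ *ᵥ Φ[l])).re = _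
  rw [hubbardTorusWith_zero_eq_sum_pairBlock_kinetic hL μ, sum_mulVec, dotProduct_sum]
  simp only [smul_mulVec, dotProduct_smul, star_pairedState_dotProduct_pairNumber_mulVec hnd, hmem,
    smul_eq_mul, mul_ite, mul_zero]
  rw [Complex.re_sum]
  simp only [apply_ite Complex.re, Complex.zero_re, Complex.re_ofReal_mul]
  rw [← Finset.sum_filter]
  have hfilter : (Finset.univ.filter fun k : TorusSite 2 L => k ∈ F) = F := by
    ext k; simp
  rw [hfilter, Finset.mul_sum]
  refine Finset.sum_congr rfl fun k _ => ?_
  norm_num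
  ring


end Literature.MathematicalPhysics.QuantumLattice

end
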